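import Literature.AnabelianGeometry.EtaleTheta.BiKummer

/-!
# [EtTh] Definition 4.1 (ii): the word "OUTER" in "the natural surjective outer homomorphism
# `Π^tp_X ↠ Aut_D(A^bs)`" — the naturality / open-kernel laws of the setting's Galois surjections, NAMED

S. Mochizuki, *The étale theta function …*, Publ. RIMS **45** (2009) [MochizukiEtTh2009], §4, Def. 4.1 (ii),
PDF p.87 (printed 313): "Suppose further that `A^bs` is Galois [cf. [SemiAnbd], Definition 3.1, (iv)], so we
have a natural surjective outer homomorphism `Π^tp_X ↠ Aut_D(A^bs)`."

The §4 setting `BiKummerSetting` (`BiKummer.lean`, abc-iut-L2-t3) carries this as the field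
`galoisSurj : ∀ A, IsGaloisObj A → (Π^tp_X →* Aut_D(A))` — ONE representative of the printed OUTER
homomorphism per Galois object, plus its surjectivity, and NO compatibility between the representatives at
different Galois objects (notes F2 / N1–N2 of abc-iut-L6-t12, 2026-08-25).  The §4–§5 discharges need that
compatibility (sub-DAG leaves T44-L09c, T56-L09c), which abc-iut-w5-d013 PROVED for the genuine temperoid
`B^temp(Π)` (`Discharge/Sec4GaloisSurjNaturalModel.lean`: `galoisSurjOf_natural`, `isOpen_ker_galoisSurjOf`;
strict naturality is FALSE as soon as some `Π/N` is non-abelian — exactly why print says "outer") and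
consumed in binder shape (`Discharge/Sec4GaloisSurjNatural.lean`, binder `hS`).

OWNER'S MERGE (this file, statements only): the laws are NAMED as predicates on a setting — not as new
FIELDS of `BiKummerSetting`.  Reason (owner ruling, gen 2, 2026-08-26T00:2xZ, "constructor-locked
structures: new properties as named predicates, not fields"): the structure has ONE constructor in the tree
(`BiKummerSetting.mkOfModel`, abc-iut-L2-t9, with `mkOfModelCanonical` and ≈ 24 call sites) and ≈ 54
importing modules; a field would force a same-wave edit of every call site and a rebuild of all of them for
no logical gain, whereas `S.GaloisSurjNatural` is definitionally d013's binder `hS` and is supplied BY NAME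
(model instance: `Discharge/Sec4GaloisSurjLawsModel.lean`).
* `BiKummerSetting.GaloisSurjNatural S` — along every base morphism `b : B → A` between Galois objects the
  two representatives agree up to an inner automorphism of `Π^tp_X`;
* `BiKummerSetting.IsOpenKerGaloisSurj S` — each representative has open kernel (the open subgroup
  `Π^tp_{A^bs} ⊆ Π^tp_X`; [SemiAnbd] Def. 3.1 (iv)).
HONEST FRAMING: definitions only; nothing of [EtTh] is asserted; nothing here bears on [IUTchIII] Cor. 3.12.
-/

namespace Literature.AnabelianGeometry.EtaleTheta

open CategoryTheory Opposite Literature.AlgebraicGeometry.Frobenioids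

namespace BiKummerSetting

universe u₀ v₀ u v w

variable {K : Type u₀} [Field K] {X : SemiGraphs.TemperedArithmeticGroup.{u₀} K} {D₀ : Type u₀}
  [Category.{v₀} D₀] {V : FrdIMonoidStub.{w}} {T : RealifiedDivisorMonoids (D₀ := D₀) V} {D : Type u}
  [Category.{v} D] {VD : FrdICatStub.{u, v, w} D}

/-- **Def. 4.1 (ii), "natural … OUTER homomorphism"** (p.87): the representatives
`galoisSurj A : Π^tp_X ↠ Aut_D(A)` of the setting are NATURAL UP TO INNER AUTOMORPHISMS — for every morphism
`b : B → A` of `D` between Galois objects there is `c ∈ Π^tp_X` with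
`b ∘ galoisSurj_B(g) = galoisSurj_A(c g c⁻¹) ∘ b` for all `g ∈ Π^tp_X` (exactly the binder `hS` of
`Discharge/Sec4GaloisSurjNatural.lean`; holds at the genuine temperoid, `galoisSurjOf_natural`; the strict
form `c = 1` is false in general).  TODO-merge(abc-iut-L3-t2): [SemiAnbd] Def. 3.1 (iv).
[cite: MochizukiEtTh2009, Def 4.1 (ii) p.87] -/
def GaloisSurjNatural (S : BiKummerSetting X T D VD) : Prop :=
  ∀ ⦃A B : D⦄ (hA : S.IsGaloisObj A) (hB : S.IsGaloisObj B) (b : B ⟶ A),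
    ∃ c : X.Pi, ∀ g : X.Pi, (S.galoisSurj B hB g).hom ≫ b = b ≫ (S.galoisSurj A hA (c * g * c⁻¹)).hom

/-- **Def. 4.1 (ii)**, topological clause: each `galoisSurj A : Π^tp_X ↠ Aut_D(A)` has OPEN kernel (the open
subgroup `Π^tp_A ⊆ Π^tp_X` of the Galois tempered covering `A`; [SemiAnbd] Def. 3.1 (iv); at the genuine
temperoid: `isOpen_ker_galoisSurjOf`).  TODO-merge(abc-iut-L3-t2). [cite: MochizukiEtTh2009, Def 4.1 (ii) p.87] -/
def IsOpenKerGaloisSurj (S : BiKummerSetting X T D VD) : Prop :=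
  ∀ (A : D) (hA : S.IsGaloisObj A), IsOpen ((S.galoisSurj A hA).ker : Set X.Pi)

end BiKummerSetting

end Literature.AnabelianGeometry.EtaleTheta
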